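import Summits.ABC.StewartYu.PadicG3ParVB
import Summits.ABC.StewartYu.PadicG3ParD
import HarnessLib

/-!
# The `p`-adic Gen-3 parameter record v2 (corrected family `…V`) — part VC: allowances in the unit `Z′ = G·g·XV·LgV`

Support file (closed forms + plain theorems; no named facts). Continues `PadicG3ParVB`. Twin of `PadicG3ParD`
for the R1′ family: the budget unit is **`Zp = G·(g·XV·LgV)`** (`zerosV s ν ≥ 8·2^ν·Zp`, `zerosV_ge'`), and every
logarithmic cost of the frame's k-step / half-step / Siegel constants is a named allowance bounded by a fraction
of `Zp`:
* heights `htsV ν = 2^ν·n·LV·(g·XV + 2) ≤ 2^ν·(33/256)·Zp` (nodes `|x₁| ≤ 2^{ν+1} XsV s ≤ 2^{ν+s}(gXV+2)`, box `LV/2^s`);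
* `AHV = MordV₀₀·HV·(log 4 + 4) + HV ≤ 1.45·Zp`; `AVV = L₀V·(ŜG+n+5) log 2 ≤ Zp/4 + yloadG`;
  `AWV = MordV₀₀·(W_LV + log(n+1) + 3) ≤ 0.35·Zp`; `AYV = L₀V(G+2) + 2HV ≤ Zp/4 + G + 2 + 2HV`;
  `AY1V = L₀V + HV + W ≤ Zp/32 + 1`; `lunkV = log(L₀V+1) + n log(2LV) ≤ Zp/32 + 1`;
* `AcoefV = 3 htsV 0 + AHV + AVV + AWV`, `logKV ν = 2 lunkV + (AcoefV+1) + (AHV+AVV+AWV) + 4 htsV ν`.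

## References
* [Nesterenko2003] Yu. V. Nesterenko, LNM 1819 (2003) — Prop 3.9 (3.40), (4.19)–(4.35).
* [Yu2013] K. Yu, Acta Math. 211 (2013) — §3.1.
-/

noncomputable section

open Finset Real

namespace Summit.ABC.StewartYu

namespace PadicG3Par

variable {n : ℕ} (P : PadicG3Par n)

/-! ### The unit and the allowances -/

/-- the v2 budget unit `Zp = G · (g · XV · LgV)` (`zerosV s ν ≥ 8·2^ν·Zp`). [cite: Nesterenko2003, (4.25)] -/
def Zp : ℝ := P.G * (P.g * P.XV * P.LgV)

/-- height allowance of a stage-`ν` k-step target: `htsV ν = 2^ν · n · LV · (g XV + 2)`.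
[cite: Nesterenko2003, (4.19)–(4.21)] -/
def htsV (ν : ℕ) : ℝ := 2 ^ ν * n * P.LV * (P.g * P.XV + 2)

/-- Hasse/exponential-size allowance `AHV = MordV₀₀ · HV · (log 4 + 4) + HV`. [cite: Nesterenko2003, (3.31)–(3.33)] -/
def AHV : ℝ := P.MordV 0 0 * P.HV * (Real.log 4 + 4) + P.HV

/-- valuation/rescaling allowance `AVV = L₀V · ((ŜG + n + 5) log 2)`. [cite: Nesterenko2003, (4.26)] -/
def AVV : ℝ := P.L0V * ((P.SdG + n + 5) * Real.log 2)

/-- weight allowance `AWV = MordV₀₀ · (W_LV + log(n+1) + 3)`. [cite: Nesterenko2003, (3.35)] -/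
def AWV : ℝ := P.MordV 0 0 * (P.WLV + Real.log (n + 1) + 3)

/-- big-disc `Y₀` allowance `AYV = L₀V (G + 2) + 2 HV`. [cite: Nesterenko2003, (4.27)–(4.28)] -/
def AYV : ℝ := P.L0V * (P.G + 2) + 2 * P.HV

/-- unit-disc `Y₀` allowance plus pivot `AY1V = L₀V + HV + W`. [folklore] -/
def AY1V : ℝ := P.L0V + P.HV + P.W

/-- `log #unk` allowance `lunkV = log(L₀V + 1) + n log(2 LV)`. [folklore] -/
def lunkV : ℝ := Real.log (P.L0V + 1) + n * Real.log (2 * P.LV)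

/-- level-`0` Siegel coefficient allowance `AcoefV = 3 htsV 0 + AHV + AVV + AWV`. [cite: Nesterenko2003, (3.40)] -/
def AcoefV : ℝ := 3 * P.htsV 0 + P.AHV + P.AVV + P.AWV

/-- the Liouville constant's logarithm at a stage-`ν` target:
`logKV ν = 2 lunkV + (AcoefV + 1) + (AHV + AVV + AWV) + 4 htsV ν`. [cite: Nesterenko2003, (4.34)–(4.35)] -/
def logKV (ν : ℕ) : ℝ := 2 * P.lunkV + (P.AcoefV + 1) + (P.AHV + P.AVV + P.AWV) + 4 * P.htsV ν

/-! ### Signs and floors -/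

/-- `0 < Zp` and `G·XV ≤ Zp`, `G·LgV·64(n+1) ≤ Zp`. [folklore] -/
theorem Zp_facts : 0 < P.Zp ∧ P.G * P.XV ≤ P.Zp ∧ P.G * P.LgV * (64 * (n + 1)) ≤ P.Zp := by
  have hG : 0 < P.G := by linarith [P.eight_le_G]
  have hg := P.one_le_g
  have hX := P.sixtyfour_le_XV'
  have hL := P.one_le_LgV
  have hn0 : (0 : ℝ) ≤ n := by positivity
  have hX0 : (0 : ℝ) < P.XV := by nlinarith
  unfold Zp
  refine ⟨by positivity, ?_, ?_⟩
  · have : (P.XV : ℝ) ≤ P.g * P.XV * P.LgV := by nlinarith [mul_nonneg (by linarith : (0:ℝ) ≤ P.g - 1) hX0.le]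
    nlinarith
  · have : (P.LgV : ℝ) * (64 * (n + 1)) ≤ P.g * P.XV * P.LgV := by
      have h0 : (0 : ℝ) ≤ P.LgV := by linarith
      nlinarith [mul_nonneg (by linarith : (0:ℝ) ≤ P.g - 1) (mul_nonneg hX0.le h0)]
    nlinarith

/-- `2^36 ≤ Zp` (`G ≥ 16`, `g ≥ 1`, `XV ≥ 128`, `LgV ≥ 2^{25}`). [folklore] -/
theorem Zp_ge : (2 : ℝ) ^ 36 ≤ P.Zp := by
  have hG := P.sixteen_le_G
  have hg := P.one_le_g
  have hX := P.XV_ge_128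
  have hL : (2 : ℝ) ^ 25 ≤ P.LgV := by
    have h1 : 2 ^ 25 ≤ 2 ^ (n + 25) := Nat.pow_le_pow_right (by norm_num) (by omega)
    exact_mod_cast h1.trans P.two_pow_le_LgV
  unfold Zp
  have h1 : (128 : ℝ) * 2 ^ 25 ≤ P.XV * P.LgV := mul_le_mul hX hL (by positivity) (by positivity)
  have h2 : (P.XV : ℝ) * P.LgV ≤ P.g * P.XV * P.LgV := by
    have h0 : (0 : ℝ) ≤ P.XV * P.LgV := by positivity
    nlinarith
  have h3 : (16 : ℝ) * (128 * 2 ^ 25) ≤ P.G * (P.g * P.XV * P.LgV) :=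
    mul_le_mul hG (h1.trans h2) (by positivity) (by linarith)
  have e : (2 : ℝ) ^ 36 = 16 * (128 * 2 ^ 25) := by norm_num
  linarith

/-- `0 ≤ htsV ν`. [folklore] -/
theorem htsV_nonneg (ν : ℕ) : 0 ≤ P.htsV ν := by
  unfold htsV; have := P.one_le_g; positivity

/-- `0 ≤ AHV`, `0 ≤ AVV`, `0 ≤ AWV`, `0 ≤ lunkV`. [folklore] -/
theorem piecesV_nonneg : 0 ≤ P.AHV ∧ 0 ≤ P.AVV ∧ 0 ≤ P.AWV ∧ 0 ≤ P.lunkV := by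
  have h4 : 0 ≤ Real.log 4 + 4 := by have := Real.log_nonneg (show (1:ℝ) ≤ 4 by norm_num); linarith
  have hl2 : 0 ≤ Real.log 2 := Real.log_nonneg (by norm_num)
  have hWL := P.WLV_ge_one
  have hln : 0 ≤ Real.log ((n : ℝ) + 1) := Real.log_nonneg (by linarith [(Nat.cast_nonneg n : (0:ℝ) ≤ n)])
  have hL : (1 : ℝ) ≤ P.LV := P.one_le_LV
  refine ⟨?_, ?_, ?_, ?_⟩
  · unfold AHV; positivity
  · unfold AVV; positivity
  · unfold AWV; positivity
  · unfold lunkV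
    have h1 : 0 ≤ Real.log ((P.L0V : ℝ) + 1) := Real.log_nonneg (by linarith [(Nat.cast_nonneg P.L0V : (0:ℝ) ≤ P.L0V)])
    have h2 : 0 ≤ Real.log (2 * (P.LV : ℝ)) := Real.log_nonneg (by linarith)
    positivity

/-- `0 ≤ AcoefV`. [folklore] -/
theorem AcoefV_nonneg : 0 ≤ P.AcoefV := by
  obtain ⟨h1, h2, h3, _⟩ := P.piecesV_nonneg
  have := P.htsV_nonneg 0
  unfold AcoefV; positivity

/-! ### Every allowance is a fraction of `Zp` -/

/-- **`htsV ν ≤ 2^ν · (33/256) · Zp`** (`n g ≤ G/8`, `LV ≤ g LgV`, `XV ≥ 64(n+1)`). [folklore] -/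
theorem htsV_le (ν : ℕ) : P.htsV ν ≤ 2 ^ ν * ((33 / 256) * P.Zp) := by
  unfold htsV Zp
  have hG8 := P.cG_mul_le_G
  unfold cG at hG8
  have hg1 := P.one_le_g
  have hLV := P.LV_le_g_mul_LgV
  have hX := P.sixtyfour_le_XV'
  have hL : (0 : ℝ) ≤ P.LgV := by positivity
  have hn0 : (0 : ℝ) ≤ n := by positivity
  have h2 : (0 : ℝ) < 2 ^ ν := by positivity
  -- `n · g = n G/(8(n+1)) ≤ G/8`
  have hng : (n : ℝ) * P.g ≤ P.G / 8 := by
    rw [P.G_eq_mul_g]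
    nlinarith
  -- `n · LV · (g XV + 2) ≤ n g LgV (g XV + 2) ≤ (G/8) LgV (g XV + 2)` and `2 LgV G/8 ≤ Zp/256`
  have h1 : (n : ℝ) * P.LV * (P.g * P.XV + 2) ≤ (P.G / 8) * P.LgV * (P.g * P.XV + 2) := by
    have : (n : ℝ) * P.LV ≤ n * (P.g * P.LgV) := mul_le_mul_of_nonneg_left hLV hn0
    have h0 : 0 ≤ P.g * P.XV + 2 := by positivity
    calc (n : ℝ) * P.LV * (P.g * P.XV + 2) ≤ n * (P.g * P.LgV) * (P.g * P.XV + 2) :=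
          mul_le_mul_of_nonneg_right this h0
      _ = (n * P.g) * P.LgV * (P.g * P.XV + 2) := by ring
      _ ≤ (P.G / 8) * P.LgV * (P.g * P.XV + 2) := by
          apply mul_le_mul_of_nonneg_right _ h0
          exact mul_le_mul_of_nonneg_right hng hL
  have h3 : (P.G / 8) * P.LgV * 2 ≤ (1 / 256) * (P.G * (P.g * P.XV * P.LgV)) := by
    have hG0 : 0 ≤ P.G := by linarith
    have : (64 : ℝ) ≤ P.g * P.XV := by nlinarith
    nlinarith [mul_nonneg hG0 hL]
  calc (2 : ℝ) ^ ν * n * P.LV * (P.g * P.XV + 2) = 2 ^ ν * (n * P.LV * (P.g * P.XV + 2)) := by ring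
    _ ≤ 2 ^ ν * ((P.G / 8) * P.LgV * (P.g * P.XV + 2)) := mul_le_mul_of_nonneg_left h1 h2.le
    _ = 2 ^ ν * ((1 / 8) * (P.G * (P.g * P.XV * P.LgV)) + (P.G / 8) * P.LgV * 2) := by ring
    _ ≤ 2 ^ ν * ((1 / 8) * (P.G * (P.g * P.XV * P.LgV)) + (1 / 256) * (P.G * (P.g * P.XV * P.LgV))) := by
        gcongr
    _ = 2 ^ ν * ((33 / 256) * (P.G * (P.g * P.XV * P.LgV))) := by ring

/-- `MordV₀₀ · HV ≤ (17/64) · Zp` (`MordV₀₀ ≤ 17(n+1)LgV`, `HV ≤ G XV/(64(n+1))`, `g ≥ 1`). [folklore] -/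
theorem MordV_mul_HV_le : (P.MordV 0 0 : ℝ) * P.HV ≤ (17 / 64) * P.Zp := by
  have hM : (P.MordV 0 0 : ℝ) ≤ 17 * (n + 1) * P.LgV := by
    have := P.MordV_zero_zero_add_le; have : (0:ℝ) ≤ n := by positivity
    linarith
  have hH := P.HV_le
  have hH0 : (0 : ℝ) ≤ P.HV := by positivity
  have hg1 := P.one_le_g
  have hn1 : (0 : ℝ) < n + 1 := by positivity
  unfold Zp
  calc (P.MordV 0 0 : ℝ) * P.HV ≤ (17 * (n + 1) * P.LgV) * (P.G * P.XV / (64 * (n + 1))) :=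
        mul_le_mul hM hH hH0 (by positivity)
    _ = (17 / 64) * (P.G * (P.XV * P.LgV)) := by field_simp
    _ ≤ (17 / 64) * (P.G * (P.g * P.XV * P.LgV)) := by
        have hG0 : 0 ≤ P.G := by linarith [P.eight_le_G]
        have h0 : (0 : ℝ) ≤ P.XV * P.LgV := by positivity
        have : (P.XV : ℝ) * P.LgV ≤ P.g * P.XV * P.LgV := by nlinarith
        nlinarith [mul_le_mul_of_nonneg_left this hG0]

/-- `HV ≤ Zp/128`. [folklore] -/
theorem HV_le_Zp : (P.HV : ℝ) ≤ P.Zp / 128 := by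
  obtain ⟨_, hGX, _⟩ := P.Zp_facts
  have hH := P.HV_le
  have hn : (1 : ℝ) ≤ n := by exact_mod_cast P.hn
  have hG0 : 0 ≤ P.G := by linarith [P.eight_le_G]
  have hGX0 : 0 ≤ P.G * P.XV := by positivity
  calc (P.HV : ℝ) ≤ P.G * P.XV / (64 * (n + 1)) := hH
    _ ≤ P.G * P.XV / 128 := div_le_div_of_nonneg_left hGX0 (by norm_num) (by linarith)
    _ ≤ P.Zp / 128 := by linarith

/-- **`AHV ≤ 1.45 · Zp`**. [folklore] -/
theorem AHV_le : P.AHV ≤ (145 / 100) * P.Zp := by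
  have hMH := P.MordV_mul_HV_le
  have hH := P.HV_le_Zp
  have hκ : Real.log 4 + 4 ≤ 539 / 100 := by
    have := Real.log_two_lt_d9
    rw [show (4 : ℝ) = 2 ^ 2 by norm_num, Real.log_pow]; push_cast; linarith
  have hκ0 : 0 ≤ Real.log 4 + 4 := by have := Real.log_nonneg (show (1:ℝ) ≤ 4 by norm_num); linarith
  have hZ := P.Zp_facts.1
  unfold AHV
  have h1 : (P.MordV 0 0 : ℝ) * P.HV * (Real.log 4 + 4) ≤ (17 / 64) * P.Zp * (539 / 100) :=
    mul_le_mul hMH hκ hκ0 (by positivity)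
  nlinarith

/-- `(ŜG + n + 5) log 2 ≤ yloadG` and `G + 2 ≤ yloadG`. [folklore] -/
theorem consts_le_yloadG : ((P.SdG : ℝ) + n + 5) * Real.log 2 ≤ P.yloadG ∧ P.G + 2 ≤ P.yloadG := by
  have hl2 : 0 ≤ Real.log 2 := Real.log_nonneg (by norm_num)
  have hl2' : Real.log 2 ≤ 1 := by have := Real.log_two_lt_d9; linarith
  have h1 : 0 ≤ Real.log P.p := P.log_p_pos.le
  have h3 : (0 : ℝ) ≤ Real.log (n + 1) := Real.log_nonneg (by linarith [(Nat.cast_nonneg n : (0:ℝ) ≤ n)])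
  have hG : 0 ≤ P.G := by linarith [P.eight_le_G]
  have h4 : (0 : ℝ) ≤ ((P.SdG : ℝ) + n + 1) * Real.log 2 := by positivity
  unfold yloadG
  constructor
  · have : ((P.SdG : ℝ) + n + 5) * Real.log 2 = ((P.SdG : ℝ) + n + 1) * Real.log 2 + 4 * Real.log 2 := by ring
    rw [this]; nlinarith
  · linarith

/-- **`AVV ≤ Zp/4 + yloadG`**. [folklore] -/
theorem AVV_le : P.AVV ≤ P.Zp / 4 + P.yloadG := by
  have hL₀ := P.L0V_le
  have hY := P.yloadG_pos
  set c : ℝ := ((P.SdG : ℝ) + n + 5) * Real.log 2 with hc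
  have hc0 : 0 ≤ c := by have : 0 ≤ Real.log 2 := Real.log_nonneg (by norm_num); positivity
  have hcY : c ≤ P.yloadG := P.consts_le_yloadG.1
  have hZ := P.Zp_facts.1
  unfold AVV
  rw [← hc]
  calc (P.L0V : ℝ) * c ≤ (P.G * (P.g * P.XV * P.LgV) / (4 * P.yloadG) + 1) * c := mul_le_mul_of_nonneg_right hL₀ hc0
    _ = P.Zp / 4 * (c / P.yloadG) + c := by unfold Zp; field_simp
    _ ≤ P.Zp / 4 * 1 + P.yloadG := by
        gcongr
        exact (div_le_one hY).mpr hcY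
    _ = _ := by ring

/-- **`AYV ≤ Zp/4 + G + 2 + 2 HV`**. [folklore] -/
theorem AYV_le : P.AYV ≤ P.Zp / 4 + P.G + 2 + 2 * P.HV := by
  have hL₀ := P.L0V_le
  have hY := P.yloadG_pos
  have hG : 0 < P.G := by linarith [P.eight_le_G]
  have hGY : P.G + 2 ≤ P.yloadG := P.consts_le_yloadG.2
  have hZ := P.Zp_facts.1
  unfold AYV
  calc (P.L0V : ℝ) * (P.G + 2) + 2 * P.HV
      ≤ (P.G * (P.g * P.XV * P.LgV) / (4 * P.yloadG) + 1) * (P.G + 2) + 2 * P.HV := by gcongr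
    _ = P.Zp / 4 * ((P.G + 2) / P.yloadG) + P.G + 2 + 2 * P.HV := by unfold Zp; field_simp; ring
    _ ≤ P.Zp / 4 * 1 + P.G + 2 + 2 * P.HV := by
        gcongr
        exact (div_le_one hY).mpr hGY
    _ = _ := by ring

/-- `W_LV ≤ Zp/128` (from `(n+1) LV W_LV ≤ G XV LV/64`). [folklore] -/
theorem WLV_le_Zp : P.WLV ≤ P.Zp / 128 := by
  obtain ⟨_, hGX, _⟩ := P.Zp_facts
  have h3 := P.WLV_mul_le
  have hn : (1 : ℝ) ≤ n := by exact_mod_cast P.hn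
  have hL1 : (1 : ℝ) ≤ P.LV := P.one_le_LV
  have hWL0 : 0 ≤ P.WLV := by linarith [P.WLV_ge_one]
  -- `W_LV · 2 LV ≤ (n+1) LV W_LV ≤ G XV LV/64`, divide by `LV`
  have h1 : P.WLV * (2 * P.LV) ≤ P.G * P.XV * P.LV / 64 := by
    calc P.WLV * (2 * P.LV) ≤ ((n : ℝ) + 1) * P.LV * P.WLV := by
          have hL0 : (0 : ℝ) ≤ P.LV := by linarith
          nlinarith [mul_nonneg (by linarith : (0:ℝ) ≤ n - 1) (mul_nonneg hL0 hWL0)]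
      _ ≤ _ := h3
  have h2 : P.WLV * 2 ≤ P.G * P.XV / 64 := by
    have hL0 : (0 : ℝ) < P.LV := by linarith
    have := div_le_div_of_nonneg_right h1 hL0.le
    rw [show P.WLV * (2 * (P.LV : ℝ)) / P.LV = P.WLV * 2 by field_simp,
      show P.G * P.XV * (P.LV : ℝ) / 64 / P.LV = P.G * P.XV / 64 by field_simp] at this
    exact this
  linarith

/-- `L₀V ≤ Zp/64 + 1` (`yloadG ≥ 16`). [folklore] -/
theorem L0V_le_Zp : (P.L0V : ℝ) ≤ P.Zp / 64 + 1 := by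
  have hL₀ := P.L0V_le
  have hY16 : (16 : ℝ) ≤ P.yloadG := le_trans P.sixteen_le_G P.G_le_yloadG
  have hZ := P.Zp_facts.1
  have h1 : P.G * (P.g * P.XV * P.LgV) / (4 * P.yloadG) ≤ P.Zp / 64 := by
    unfold Zp; exact div_le_div_of_nonneg_left hZ.le (by norm_num) (by linarith)
  linarith

/-- **`AY1V ≤ Zp/32 + 1`**. [folklore] -/
theorem AY1V_le : P.AY1V ≤ P.Zp / 32 + 1 := by
  have h1 := P.L0V_le_Zp
  have h2 := P.HV_le_Zp
  have h3 := P.WLV_le_Zp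
  have hW : P.W ≤ P.WLV := by
    have := P.W_add_log_le_WLV
    have : 0 ≤ Real.log (2 * (P.LV : ℝ)) := Real.log_nonneg (by linarith [P.one_le_LV])
    linarith
  unfold AY1V
  linarith

/-- **`AWV ≤ 0.35 · Zp`** (`(n+1)LgV·W_LV ≤ Zp/64`, `(n+1)LgV·log(n+1) ≤ Zp/512`, `3(n+1)LgV ≤ 3Zp/1024`). [folklore] -/
theorem AWV_le : P.AWV ≤ (35 / 100) * P.Zp := by
  obtain ⟨hZ, _, hGL⟩ := P.Zp_facts
  have hM : (P.MordV 0 0 : ℝ) ≤ 17 * (n + 1) * P.LgV := by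
    have := P.MordV_zero_zero_add_le; have : (0:ℝ) ≤ n := by positivity
    linarith
  have h1 := P.WLV_mul_le
  have hLgV := P.LgV_le_LV
  have hLgV' : (P.LgV : ℝ) ≤ P.LV := by exact_mod_cast hLgV
  have hLVg := P.LV_le_g_mul_LgV
  have hn := P.n_le
  have hG16 := P.sixteen_le_G
  have hL : (0 : ℝ) ≤ P.LgV := by positivity
  have hn0 : (0 : ℝ) ≤ n := by positivity
  have hlog : Real.log ((n : ℝ) + 1) ≤ n := by
    have := Real.log_le_sub_one_of_pos (show (0 : ℝ) < n + 1 by positivity); linarith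
  have hlog0 : 0 ≤ Real.log ((n : ℝ) + 1) := Real.log_nonneg (by linarith)
  have hWL := P.WLV_ge_one
  have hWL0 : 0 ≤ P.WLV := by linarith
  -- (a) `(n+1) LgV W_LV ≤ (n+1) LV W_LV ≤ G XV LV/64 ≤ Zp/64`
  have hA : ((n : ℝ) + 1) * P.LgV * P.WLV ≤ P.Zp / 64 := by
    have hG0 : 0 ≤ P.G := by linarith
    have hX0 : (0 : ℝ) ≤ P.XV := by positivity
    calc ((n : ℝ) + 1) * P.LgV * P.WLV ≤ ((n : ℝ) + 1) * P.LV * P.WLV := by gcongr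
      _ ≤ P.G * P.XV * P.LV / 64 := h1
      _ ≤ P.G * P.XV * (P.g * P.LgV) / 64 := by gcongr
      _ = P.Zp / 64 := by unfold Zp; ring
  -- (b) `(n+1) LgV log(n+1) ≤ (n+1) LgV (G/8) ≤ Zp/512`
  have hB : ((n : ℝ) + 1) * P.LgV * Real.log (n + 1) ≤ P.Zp / 512 := by
    have : ((n : ℝ) + 1) * P.LgV * Real.log (n + 1) ≤ ((n : ℝ) + 1) * P.LgV * (P.G / 8) := by
      apply mul_le_mul_of_nonneg_left _ (by positivity); linarith
    nlinarith
  -- (c) `3 (n+1) LgV ≤ 3 Zp/(64 G) ≤ 3 Zp/1024`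
  have hC : ((n : ℝ) + 1) * P.LgV * 3 ≤ 3 * P.Zp / 1024 := by nlinarith
  have hsum : ((n : ℝ) + 1) * P.LgV * (P.WLV + Real.log (n + 1) + 3) ≤ (21 / 1024) * P.Zp := by nlinarith
  have hpos : 0 ≤ P.WLV + Real.log ((n : ℝ) + 1) + 3 := by positivity
  unfold AWV
  calc (P.MordV 0 0 : ℝ) * (P.WLV + Real.log (n + 1) + 3)
      ≤ (17 * (n + 1) * P.LgV) * (P.WLV + Real.log (n + 1) + 3) := mul_le_mul_of_nonneg_right hM hpos
    _ = 17 * (((n : ℝ) + 1) * P.LgV * (P.WLV + Real.log (n + 1) + 3)) := by ring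
    _ ≤ 17 * ((21 / 1024) * P.Zp) := mul_le_mul_of_nonneg_left hsum (by norm_num)
    _ ≤ (35 / 100) * P.Zp := by nlinarith

/-- **`lunkV ≤ Zp/32 + 1`**. [folklore] -/
theorem lunkV_le : P.lunkV ≤ P.Zp / 32 + 1 := by
  have hL₀ := P.L0V_le_Zp
  have hlog1 : Real.log ((P.L0V : ℝ) + 1) ≤ P.L0V := by
    have := Real.log_le_sub_one_of_pos (show (0 : ℝ) < P.L0V + 1 by positivity); linarith
  have h2 := P.WLV_mul_le
  have hlog2 : Real.log (2 * (P.LV : ℝ)) ≤ P.WLV := by have := P.W_add_log_le_WLV; linarith [P.hW]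
  have hlog20 : 0 ≤ Real.log (2 * (P.LV : ℝ)) := Real.log_nonneg (by linarith [P.one_le_LV])
  have hLVg := P.LV_le_g_mul_LgV
  have hn : (n : ℝ) * Real.log (2 * P.LV) ≤ P.Zp / 64 := by
    have hWL0 : 0 ≤ P.WLV := by linarith [P.WLV_ge_one]
    have : (n : ℝ) ≤ (n + 1) * P.LV := by nlinarith [P.one_le_LV, (Nat.cast_nonneg n : (0:ℝ) ≤ n)]
    have hG0 : 0 ≤ P.G := by linarith [P.eight_le_G]
    have hX0 : (0 : ℝ) ≤ P.XV := by positivity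
    calc (n : ℝ) * Real.log (2 * P.LV) ≤ ((n : ℝ) + 1) * P.LV * P.WLV :=
          mul_le_mul this hlog2 hlog20 (by positivity)
      _ ≤ P.G * P.XV * P.LV / 64 := h2
      _ ≤ P.G * P.XV * (P.g * P.LgV) / 64 := by gcongr
      _ = P.Zp / 64 := by unfold Zp; ring
  unfold lunkV
  linarith

/-- `log XV ≤ XV/4` (as `XV ≥ 128`). [folklore] -/
theorem log_XV_le : Real.log (P.XV : ℝ) ≤ P.XV / 4 := by
  have hX := P.XV_ge_128
  have hy : (0 : ℝ) ≤ P.XV / 4 := by linarith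
  have h1 := Real.quadratic_le_exp_of_nonneg hy
  have h2 : (P.XV : ℝ) ≤ Real.exp (P.XV / 4) := by nlinarith
  calc Real.log (P.XV : ℝ) ≤ Real.log (Real.exp (P.XV / 4)) := Real.log_le_log (by linarith) h2
    _ = P.XV / 4 := Real.log_exp _

/-- `log g ≤ g − 1 ≤ G/16` and `g ≤ G/16`. [folklore] -/
theorem g_le_G_div : P.g ≤ P.G / 16 ∧ Real.log P.g ≤ P.G / 16 := by
  have hg := P.one_le_g
  have hn : (1 : ℝ) ≤ n := by exact_mod_cast P.hn
  have h1 : P.g ≤ P.G / 16 := by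
    rw [P.G_eq_mul_g]; nlinarith
  refine ⟨h1, ?_⟩
  have := Real.log_le_sub_one_of_pos (lt_of_lt_of_le one_pos hg)
  linarith

end PadicG3Par

end Summit.ABC.StewartYu
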